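import Summits.ResolutionOfSingularities.ResolutionOfSingularities.Theses.RuledResidues
import Summits.ResolutionOfSingularities.ResolutionOfSingularities.Theorems.NonRuledCofinite.Negative.FalseWithoutSingularCentre
import Literature.AlgebraicGeometry.Resolution.DivisorialPlace
import HarnessLib

/-!
# Disproof of `RegularModelRuled` (stmt-ResolutionOfSingularities-18077) — findings

Standing disprover's work file (cdisprove, cycle 1, 2026-08-17) for the crux
`RuledResidues.RegularModelRuled` (Abhyankar's ruledness: a divisorial place `W` of `K/k` dominating
a REGULAR local ring `A_𝔮` of dimension `≥ 2` of an affine model `A` of `K` has ruled residue field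
`κ(W) = L(t)`, `k ⊆ L`, `t` transcendental over `L`). Prose only in docstrings; every claim that is
not kernel-checked says so.

## Findings

0. **NO KILL IS POSSIBLE — the crux is a theorem with a kernel-checked proof.** The crux work file
   `Cruxes/RegularModelRuled/RuledResiduesRegularModelRuled.lean` (planner-cstrat, line `dvr-descent`
   v4, sha256 `4f481f72…`) proves `RuledResidues.RegularModelRuled` outright; this seat re-ran it:
   `lean check` rc 0, 0 sorries, 0 warnings, `#print axioms regularModelRuled_proof` =
   `{propext, Classical.choice, Quot.sound}`, audit `proof-of-item closed = true`. It awaits a PROVER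
   to land it verbatim at `Theorems/RuledResiduesRegularModelRuled.lean --workitem
   stmt-ResolutionOfSingularities-18077`. On paper it is Abhyankar 1956 Prop. 3–4 (Zariski–Samuel II,
   Ch. VI §14; Ishii–Kollár arXiv:math/0207171 Ex. 2.5). Consequently every `¬`-attack below is an
   attack on a HYPOTHESIS, never on the crux.
1. **Read-back** (agrees with the birth refuter's BRIEFING): no junk operators; `s ∉ W.nonunits` =
   "`s` is a unit of `W`"; the centre `comap (inclusion h) 𝔪_W` is the tree's `subringCentre` by
   `rfl`; `IsRegularLocalRing` is Mathlib's class; the conclusion is not trivially satisfiable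
   (`L = ⊤` is excluded by `f = X - C t`). Hypotheses are jointly satisfiable WITH `dim ≥ 2`
   (paper: `K = k(x,y)`, `W = ord_{(x,y)} = k[x, y/x]_{(x)}`, `A = k[x,y]`; `L = k`, `t = y/x`).
2. **Load-bearing analysis** (section (a) below):
   * `2 ≤ ringKrullDim A_𝔮` — LOAD-BEARING, KERNEL-CHECKED here
     (`regularModelRuled_false_without_dimTwo`; landed as
     `Theorems/RegularModelRuled/Negative/FalseWithoutDimTwo.lean`, proposal p154836): `k = 𝔽₂`,
     `K = k(X)`, `W = k[X]_{(X)}`, `A = k[X]` — `A_{(X)} = W` is regular of dimension one and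
     `κ(W) = k` has no element transcendental over any `L ⊇ k`.
   * `IsRegularLocalRing A_𝔮` — LOAD-BEARING on paper (`regularModelRuled_false_without_regular`,
     `sorry`): cone over a non-rational curve. Cheapest certifiable instance: `k = ℝ`,
     `A = ℝ[x,y,z]/(x² + y² + z²)` (vertex `𝔮`, `dim A_𝔮 = 2`, embedding dimension 3), `W` = the
     order valuation at the vertex (= the exceptional curve of the blow-up), `κ(W) = ℝ(C)`, `C` the
     pointless conic `u² + v² + 1 = 0`; `ℝ(C) ≠ L(t)`: `L` is algebraic over `ℝ`, `i ∉ ℝ(C)` forces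
     `L = ℝ`, and `u = f/g`, `v = p/q ∈ ℝ(t)` gives `(fq)² + (pg)² + (gq)² = 0` in `ℝ[t]`, impossible.
     Characteristic-free instance: the cone over the Fermat cubic (non-rationality by Mathlib's
     `Polynomial.flt_catalan`). Obstruction to a Lean proof: building `K`, `W`, `A` needs
     irreducibility of the quadric/cubic and a residue-field computation of an order valuation of a
     SINGULAR ring (the tree's `exceptionalResidue` is for regular `S` only) — est. > 600 lines.
   * `IsFractionRing A K` — LOAD-BEARING on paper (`regularModelRuled_false_without_isFractionRing`,
     `sorry`): `K = F(x)` with `F/k` a NON-ruled function field of one variable (`F = ℝ(C)` as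
     above, or an elliptic function field), `W = F[x]_{(x)}` (divisorial, `κ(W) = F`),
     `A = k[x, x·e]` with `e ∈ F ∖ k` (`≅ k[s,t]`, so `A_{(s,t)}` is regular of dimension 2,
     `A ⊆ W`, but `Frac A = k(x, xe) ⊊ K`). Same obstruction (non-ruledness certificate for `F`).
   * the divisorial clause `∃ B, B.FG ∧ B ⊆ W ∧ W = B_{𝔪 ∩ B}` — LOAD-BEARING on paper
     (`regularModelRuled_false_without_model`, `sorry`): the arc valuation
     `ν(f) = ord_t f(t, σ(t))` on `k(x,y)`, `σ ∈ t·k⟦t⟧` transcendental over `k(t)`: a DVR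
     dominating `k[x,y]_{(x,y)}` (regular, dim 2) with `κ = k` — not ruled. Obstruction:
     transcendence of a power series over `k(t)` in Lean.
   * `IsDiscreteValuationRing W` — NOT load-bearing: REDUNDANT given the divisorial clause and
     `dim A_𝔮 ≥ 2` (`W = B_𝔭` is a Noetherian valuation ring; if it were a field then `𝔪_W = ⊥`,
     `𝔮 = ⊥`, `dim A_𝔮 = 0`). KERNEL-CHECKED: `isDiscreteValuationRing_redundant` and
     `regularModelRuledWithoutDVR_iff` below; landed as
     `Theorems/RegularModelRuled/Negative/DVRBinderDerivable.lean` (p155038; neither `A.FG` nor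
     `Frac A = K` nor regularity is used).
   * `hk : k ⊆ W` — a binder used by the conclusion; derivable from the divisorial clause
     (`k ⊆ B ⊆ W`).
3. **Tightness / strengthenings** (sections (b), (c)): the conclusion CANNOT be strengthened to
   "`κ(W)` purely transcendental over (the algebraic closure of) `k`" (paper: `A = k[x,y,z]`,
   `𝔮 = (z, g(x,y))` the generic point of a non-rational plane curve `g = 0`, `W = ord_𝔮`:
   `κ(W) = k(g)(t)` is ruled but not rational) — so the witness side of the route must test
   NON-RULEDNESS, not non-rationality. What the proof actually gives is STRONGER than the crux and
   TRUE: `κ(W) = κ(S)(t₁, …, t_c)`, `c = dim S - 1 ≥ 1`, for a regular local ring `S ⊇ A_𝔮` of `K`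
   (the penultimate quadratic transform), so in particular `L ⊇ κ(𝔮)` and `L/k` is finitely
   generated — neither is a refutable strengthening.
4. **Targets**: none (payload `stuck_stubs = []`; the three stubs of line `dvr-descent` —
   `stub_ratFuncRuled`, `stub_centreEqOfPrime`, `stub_chartQuotient` — are all PROVED in v4).

## Why it resists

It is a theorem. The only conceivable failure modes were transcription slips (junk coercions, a
missing side condition); the read-back found none, and the one-hypothesis-deleted variants fail for
the classical reasons above, each needing an object (non-rational curve, transcendental arc) that is
genuinely absent when the hypothesis is present.
-/

noncomputable section

-- single-problem summit: the doubled namespace component `ResolutionOfSingularities` is forced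
set_option linter.dupNamespace false

open Polynomial IsDedekindDomain IsLocalRing
open Literature.AlgebraicGeometry.Resolution
open Summit.ResolutionOfSingularities.ResolutionOfSingularities.Theorems.NonRuledCofinite.Negative

namespace Summit.ResolutionOfSingularities.ResolutionOfSingularities.Cruxes.RegularModelRuled.Disproof

/-! ## (a) Load-bearing analysis — one hypothesis deleted at a time

Each `RegularModelRuledWithout<H>` is the crux `RuledResidues.RegularModelRuled` verbatim with the
hypothesis `H` deleted (and nothing else changed). -/

/-- The ruledness conclusion of the crux, for a valuation ring `W ⊇ k` of `K`: `κ(W) = L(t)` with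
`k ⊆ L` and `t` transcendental over `L` (verbatim the crux's last three conjuncts). -/
def RuledConclusion (k K : Type) [Field k] [Field K] [Algebra k K] (W : ValuationSubring K)
    (hk : ∀ c : k, algebraMap k K c ∈ W) : Prop :=
  ∃ (L : Subfield (IsLocalRing.ResidueField W)) (t : IsLocalRing.ResidueField W),
    (∀ c : k, IsLocalRing.residue W ⟨algebraMap k K c, hk c⟩ ∈ L) ∧
    (∀ f : Polynomial L, f ≠ 0 → Polynomial.eval₂ L.subtype t f ≠ 0) ∧
    (∀ x : IsLocalRing.ResidueField W, ∃ f g : Polynomial L,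
      Polynomial.eval₂ L.subtype t g ≠ 0 ∧
      x * Polynomial.eval₂ L.subtype t g = Polynomial.eval₂ L.subtype t f)

/-- The divisorial clause of the crux: `W` is essentially of finite type over `k`
(`W = B_{𝔪_W ∩ B}` for a finitely generated `B ⊆ W`). -/
def HasModel (k K : Type) [Field k] [Field K] [Algebra k K] (W : ValuationSubring K) : Prop :=
  ∃ B : Subalgebra k K, B.FG ∧ B.toSubring ≤ W.toSubring ∧
    ∀ x : K, x ∈ W → ∃ b s : K, b ∈ B ∧ s ∈ B ∧ s ∉ W.nonunits ∧ x * s = b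

/-- Sanity: the crux IS `∀ …, RuledConclusion` over its telescope (definitional unfolding of the two
abbreviations above). -/
theorem regularModelRuled_iff :
    Summit.ResolutionOfSingularities.ResolutionOfSingularities.Theses.RuledResidues.RegularModelRuled ↔
      ∀ (k K : Type) [Field k] [Field K] [Algebra k K] (W : ValuationSubring K)
        (hk : ∀ c : k, algebraMap k K c ∈ W), IsDiscreteValuationRing W → HasModel k K W →
        ∀ A : Subalgebra k K, A.FG → IsFractionRing A K → ∀ h : A.toSubring ≤ W.toSubring,
        IsRegularLocalRing (Localization.AtPrime
          (Ideal.comap (Subring.inclusion h) (IsLocalRing.maximalIdeal W))) →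
        (2 : WithBot ℕ∞) ≤ ringKrullDim (Localization.AtPrime
          (Ideal.comap (Subring.inclusion h) (IsLocalRing.maximalIdeal W))) →
        RuledConclusion k K W hk :=
  Iff.rfl

/-- The crux with the dimension hypothesis `2 ≤ ringKrullDim A_𝔮` DELETED. -/
def RegularModelRuledWithoutDimTwo : Prop :=
  ∀ (k K : Type) [Field k] [Field K] [Algebra k K] (W : ValuationSubring K)
    (hk : ∀ c : k, algebraMap k K c ∈ W), IsDiscreteValuationRing W → HasModel k K W →
    ∀ A : Subalgebra k K, A.FG → IsFractionRing A K → ∀ h : A.toSubring ≤ W.toSubring,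
    IsRegularLocalRing (Localization.AtPrime
      (Ideal.comap (Subring.inclusion h) (IsLocalRing.maximalIdeal W))) →
    RuledConclusion k K W hk

/-- The crux with the regularity hypothesis `IsRegularLocalRing A_𝔮` DELETED. -/
def RegularModelRuledWithoutRegular : Prop :=
  ∀ (k K : Type) [Field k] [Field K] [Algebra k K] (W : ValuationSubring K)
    (hk : ∀ c : k, algebraMap k K c ∈ W), IsDiscreteValuationRing W → HasModel k K W →
    ∀ A : Subalgebra k K, A.FG → IsFractionRing A K → ∀ h : A.toSubring ≤ W.toSubring,
    (2 : WithBot ℕ∞) ≤ ringKrullDim (Localization.AtPrime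
      (Ideal.comap (Subring.inclusion h) (IsLocalRing.maximalIdeal W))) →
    RuledConclusion k K W hk

/-- The crux with `IsFractionRing A K` (`Frac A = K`) DELETED. -/
def RegularModelRuledWithoutIsFractionRing : Prop :=
  ∀ (k K : Type) [Field k] [Field K] [Algebra k K] (W : ValuationSubring K)
    (hk : ∀ c : k, algebraMap k K c ∈ W), IsDiscreteValuationRing W → HasModel k K W →
    ∀ A : Subalgebra k K, A.FG → ∀ h : A.toSubring ≤ W.toSubring,
    IsRegularLocalRing (Localization.AtPrime
      (Ideal.comap (Subring.inclusion h) (IsLocalRing.maximalIdeal W))) →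
    (2 : WithBot ℕ∞) ≤ ringKrullDim (Localization.AtPrime
      (Ideal.comap (Subring.inclusion h) (IsLocalRing.maximalIdeal W))) →
    RuledConclusion k K W hk

/-- The crux with the divisorial clause `HasModel` (`W` essentially of finite type) DELETED. -/
def RegularModelRuledWithoutModel : Prop :=
  ∀ (k K : Type) [Field k] [Field K] [Algebra k K] (W : ValuationSubring K)
    (hk : ∀ c : k, algebraMap k K c ∈ W), IsDiscreteValuationRing W →
    ∀ A : Subalgebra k K, A.FG → IsFractionRing A K → ∀ h : A.toSubring ≤ W.toSubring,
    IsRegularLocalRing (Localization.AtPrime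
      (Ideal.comap (Subring.inclusion h) (IsLocalRing.maximalIdeal W))) →
    (2 : WithBot ℕ∞) ≤ ringKrullDim (Localization.AtPrime
      (Ideal.comap (Subring.inclusion h) (IsLocalRing.maximalIdeal W))) →
    RuledConclusion k K W hk

/-- The crux with `IsDiscreteValuationRing W` DELETED (this one is NOT weaker: see
`isDiscreteValuationRing_redundant`). -/
def RegularModelRuledWithoutDVR : Prop :=
  ∀ (k K : Type) [Field k] [Field K] [Algebra k K] (W : ValuationSubring K)
    (hk : ∀ c : k, algebraMap k K c ∈ W), HasModel k K W →
    ∀ A : Subalgebra k K, A.FG → IsFractionRing A K → ∀ h : A.toSubring ≤ W.toSubring,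
    IsRegularLocalRing (Localization.AtPrime
      (Ideal.comap (Subring.inclusion h) (IsLocalRing.maximalIdeal W))) →
    (2 : WithBot ℕ∞) ≤ ringKrullDim (Localization.AtPrime
      (Ideal.comap (Subring.inclusion h) (IsLocalRing.maximalIdeal W))) →
    RuledConclusion k K W hk

/-! ### `dim ≥ 2` is load-bearing — KERNEL-CHECKED (landed: `Negative/FalseWithoutDimTwo.lean`) -/

variable {k : Type} [Field k]

variable (k) in
/-- The polynomial model `k[X] ⊆ k(X)`, as a subring, is a principal ideal ring. [folklore] -/
theorem isPrincipalIdealRing_polyModel_toSubring :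
    IsPrincipalIdealRing (polyModel k).toSubring := by
  let f : k[X] →+* (polyModel k).toSubring :=
    (algebraMap k[X] (RatFunc k)).codRestrict (polyModel k).toSubring
      (fun p => algebraMap_mem_polyModel k p)
  refine IsPrincipalIdealRing.of_surjective f fun y => ?_
  obtain ⟨p, hp⟩ := (mem_polyModel_iff k).mp y.2
  exact ⟨p, Subtype.ext hp⟩

/-- Every local ring of the polynomial model is regular (`k[X]` is Dedekind). [folklore] -/
theorem isRegularLocalRing_localization_polyModel (q : Ideal (polyModel k).toSubring)
    [q.IsPrime] : IsRegularLocalRing (Localization.AtPrime q) :=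
  haveI := isPrincipalIdealRing_polyModel_toSubring k
  IsRegularRing.isRegularLocalRing_localization q

/-- The residue field of the place `X = c` of `k(X)` is `k`: every residue is the residue of a
constant (`n/d ↦ n(c)/d(c)`). [folklore] -/
theorem exists_residue_algebraMap_eq (c : k)
    (z : IsLocalRing.ResidueField (place (linPlace c))) :
    ∃ a : k, IsLocalRing.residue (place (linPlace c))
      ⟨algebraMap k (RatFunc k) a, algebraMap_base_mem_place _ a⟩ = z := by
  obtain ⟨w, hw⟩ :=
    Ideal.Quotient.mk_surjective (I := IsLocalRing.maximalIdeal (place (linPlace c))) z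
  obtain ⟨n, d, hnd⟩ := HeightOneSpectrum.exists_primeCompl_mul_eq_of_integer (linPlace c)
    (w : RatFunc k) ((mem_place_iff_valuation_le_one _ _).mp w.2)
  have hd0 : (d : k[X]).eval c ≠ 0 := by
    intro h0
    apply d.2
    change (d : k[X]) ∈ Ideal.span {X - C c}
    rw [Ideal.mem_span_singleton, dvd_iff_isRoot]
    exact h0
  refine ⟨n.eval c / (d : k[X]).eval c, ?_⟩
  set a : k := n.eval c / (d : k[X]).eval c with ha
  have hu : IsUnit (algebraMap k[X] (place (linPlace c)) (d : k[X])) :=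
    IsLocalization.map_units (place (linPlace c)) d
  have hmem : algebraMap k[X] (place (linPlace c)) (C a * (d : k[X]) - n) ∈
      IsLocalRing.maximalIdeal (place (linPlace c)) := by
    refine (IsLocalization.AtPrime.to_map_mem_maximal_iff (place (linPlace c))
      (linPlace c).asIdeal _).mpr ?_
    change C a * (d : k[X]) - n ∈ Ideal.span {X - C c}
    rw [Ideal.mem_span_singleton, dvd_iff_isRoot, IsRoot.def, eval_sub, eval_mul, eval_C, ha,
      div_mul_cancel₀ _ hd0, sub_self]
  have hprod : ((⟨algebraMap k (RatFunc k) a, algebraMap_base_mem_place _ a⟩ :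
      place (linPlace c)) - w) * algebraMap k[X] (place (linPlace c)) (d : k[X]) =
        algebraMap k[X] (place (linPlace c)) (C a * (d : k[X]) - n) := by
    apply Subtype.ext
    change (algebraMap k (RatFunc k) a - (w : RatFunc k)) * algebraMap k[X] (RatFunc k) (d : k[X]) =
      algebraMap k[X] (RatFunc k) (C a * (d : k[X]) - n)
    rw [map_sub, map_mul, ← hnd, IsScalarTower.algebraMap_apply k k[X] (RatFunc k) a,
      Polynomial.algebraMap_eq]
    ring
  have H : (⟨algebraMap k (RatFunc k) a, algebraMap_base_mem_place _ a⟩ : place (linPlace c)) - w ∈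
      IsLocalRing.maximalIdeal (place (linPlace c)) := by
    rw [← Ideal.mul_unit_mem_iff_mem _ hu, hprod]
    exact hmem
  rw [← hw]
  exact (Ideal.Quotient.eq (I := IsLocalRing.maximalIdeal (place (linPlace c)))).mpr H

/-- **Any proof of the crux must use `2 ≤ dim A_𝔮`** (KERNEL-CHECKED; landed verbatim — with the
telescope inlined — as `Theorems/RegularModelRuled/Negative/FalseWithoutDimTwo.lean`,
`regularModelRuled_false_without_dimTwo`, p154836). Witness: `k = 𝔽₂`, `K = k(X)`,
`W = k[X]_{(X)}`, `A = k[X]`: all hypotheses but the dimension hold (`A_{(X)} = W` is a DVR, regular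
of dimension ONE) and `κ(W) = k`, so any `t` lies in `L` and is a root of `X - C t ≠ 0`. [folklore] -/
theorem regularModelRuled_false_without_dimTwo : ¬ RegularModelRuledWithoutDimTwo := by
  intro h
  obtain ⟨L, t, hL, htr, -⟩ := h (ZMod 2) (RatFunc (ZMod 2)) (place (linPlace (0 : ZMod 2)))
    (algebraMap_base_mem_place _) inferInstance (place_essFiniteType _) (polyModel (ZMod 2))
    (polyModel_fg (ZMod 2)) inferInstance (polyModel_le_place _)
    (isRegularLocalRing_localization_polyModel _)
  obtain ⟨a, ha⟩ := exists_residue_algebraMap_eq (0 : ZMod 2) t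
  have htL : t ∈ L := ha ▸ hL a
  refine htr (Polynomial.X - Polynomial.C ⟨t, htL⟩) (Polynomial.X_sub_C_ne_zero _) ?_
  rw [Polynomial.eval₂_sub, Polynomial.eval₂_X, Polynomial.eval₂_C]
  exact sub_self t

/-! ### The other hypotheses — paper witnesses (NOT kernel-checked; `sorry` = near-miss record) -/

/-- **Regularity of `A_𝔮` is load-bearing** (PAPER, not kernel-checked). Witness: `k = ℝ`,
`A = ℝ[x,y,z]/(x² + y² + z²) ⊆ K = Frac A`, `𝔮` the vertex (`dim A_𝔮 = 2`, not regular), `W` the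
order valuation of `A_𝔮` (the exceptional curve of the blow-up of the vertex; divisorial, model
`B = A[y/x, z/x]`), `κ(W) = Frac ℝ[u,v]/(u² + v² + 1)` = the pointless conic, NOT `L(t)`: `L/ℝ`
algebraic and `√-1 ∉ κ(W)` give `L = ℝ`; then `u = f/g`, `v = p/q` in `ℝ(t)` give
`(fq)² + (pg)² + (gq)² = 0` in `ℝ[t]`, forcing `gq = 0`. Characteristic-free variant: the cone over
the Fermat cubic, non-rational by `Polynomial.flt_catalan`. Obstruction to closing in Lean:
irreducibility of the defining form, the order valuation of a SINGULAR two-dimensional ring and its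
residue field (the tree's chart calculus `exceptionalResidue` needs `S` regular). [folklore] -/
theorem regularModelRuled_false_without_regular : ¬ RegularModelRuledWithoutRegular := by
  sorry

/-- **`Frac A = K` is load-bearing** (PAPER, not kernel-checked). Witness: `F/k` a non-ruled
function field of one variable (e.g. `k = ℝ`, `F = ℝ(C)` the pointless conic; or an elliptic
function field), `K = F(x)`, `W = F[x]_{(x)}` (divisorial: `W = B_{(x)}` for `B = R[x]`, `R` an
affine model of `F`; `κ(W) = F`), `A = k[x, x·e]` for any `e ∈ F ∖ k̄`: `x, xe` are algebraically
independent so `A ≅ k[s,t]`, its centre is `(s,t)`, `A_{(s,t)}` is regular of dimension `2`, `A ⊆ W`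
— but `Frac A = k(x, xe) ≠ K`, and `κ(W) = F` is not ruled. Obstruction: as above, a non-ruledness
certificate for `F`. [folklore] -/
theorem regularModelRuled_false_without_isFractionRing : ¬ RegularModelRuledWithoutIsFractionRing := by
  sorry

/-- **The divisorial clause (`W` essentially of finite type) is load-bearing** (PAPER, not
kernel-checked). Witness: `k` any field, `K = k(x,y)`, `σ(t) ∈ t·k⟦t⟧` transcendental over `k(t)`
(e.g. `Σ t^{n!}`), `W = {f | ord_t f(t, σ(t)) ≥ 0}`: a DVR of `K` (trivial support by
transcendence) dominating `A_{(x,y)}`, `A = k[x,y]` (regular, dimension 2), with residue field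
`κ(W) = k` — no transcendental `t`. (`W` is the union of the INFINITE quadratic sequence along the
arc; Abhyankar's finiteness fails exactly here.) Obstruction: transcendence of a lacunary power
series over `k(t)` and the valuation it induces, in Lean. [folklore] -/
theorem regularModelRuled_false_without_model : ¬ RegularModelRuledWithoutModel := by
  sorry

/-! ### `IsDiscreteValuationRing W` is NOT load-bearing (redundant) -/

/-- **The DVR conjunct is decoration** (KERNEL-CHECKED): under the divisorial clause `W = B_𝔭` is
a localisation of a Noetherian ring (`isLocalization_atPrime_of_model`), hence a Noetherian
valuation ring, i.e. a DVR or a field; and `W` a field means `𝔪_W = ⊥`, so the centre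
`𝔮 = comap 𝔪_W = ⊥` has height `0` and `dim A_𝔮 = 0 < 2`. Neither `A.FG` nor `Frac A = K` nor
regularity is used. Hence `RegularModelRuledWithoutDVR ↔ RegularModelRuled`
(`regularModelRuledWithoutDVR_iff`); since the crux is PROVED with the conjunct present, nothing
hinges on this. [cite: ZariskiSamuel1960, Ch. VI §14, Corollary preceding Thm. 32] -/
theorem isDiscreteValuationRing_redundant (k K : Type) [Field k] [Field K] [Algebra k K]
    (W : ValuationSubring K) (hW : HasModel k K W) (A : Subalgebra k K)
    (h : A.toSubring ≤ W.toSubring)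
    (hdim : (2 : WithBot ℕ∞) ≤ ringKrullDim (Localization.AtPrime
      (Ideal.comap (Subring.inclusion h) (IsLocalRing.maximalIdeal W)))) :
    IsDiscreteValuationRing W := by
  obtain ⟨B, hBfg, hBW, hloc⟩ := hW
  haveI : Algebra.FiniteType k B := B.fg_iff_finiteType.mp hBfg
  haveI : IsNoetherianRing B := Algebra.FiniteType.isNoetherianRing k B
  letI := (Subring.inclusion hBW : B →+* W).toAlgebra
  haveI := isLocalization_atPrime_of_model W hBW hloc
  haveI : IsNoetherianRing W :=
    IsLocalization.isNoetherianRing (centreIdeal B W hBW).primeCompl _ inferInstance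
  have hnf : ¬ IsField W := by
    intro hF
    have hbot : IsLocalRing.maximalIdeal W = ⊥ :=
      (IsLocalRing.isField_iff_maximalIdeal_eq).mp hF
    have hq : Ideal.comap (Subring.inclusion h) (IsLocalRing.maximalIdeal W) = ⊥ := by
      rw [hbot]
      exact Ideal.comap_bot_of_injective (Subring.inclusion h) (Subring.inclusion_injective h)
    have e := IsLocalization.AtPrime.ringKrullDim_eq_height
      (Ideal.comap (Subring.inclusion h) (IsLocalRing.maximalIdeal W))
      (Localization.AtPrime (Ideal.comap (Subring.inclusion h) (IsLocalRing.maximalIdeal W)))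
    rw [e, hq, Ideal.height_bot] at hdim
    exact absurd hdim (by decide)
  have hV : ValuationRing W := inferInstance
  exact ((IsDiscreteValuationRing.TFAE W hnf).out 0 1).mpr hV

/-- `IsDiscreteValuationRing W` can be deleted from the crux without changing it. [folklore] -/
theorem regularModelRuledWithoutDVR_iff :
    RegularModelRuledWithoutDVR ↔
      Summit.ResolutionOfSingularities.ResolutionOfSingularities.Theses.RuledResidues.RegularModelRuled := by
  constructor
  · intro hS k K _ _ _ W hk _ hdiv A hAfg hAfr h hreg hdim
    exact hS k K W hk hdiv A hAfg hAfr h hreg hdim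
  · intro hS k K _ _ _ W hk hdiv A hAfg hAfr h hreg hdim
    exact hS k K W hk (isDiscreteValuationRing_redundant k K W hdiv A h hdim) hdiv A hAfg hAfr h
      hreg hdim

/-! ## (b) Tightness — recorded on paper

The conclusion `κ(W) = L(t)` cannot be improved to "`κ(W)` purely transcendental over `k`" (or over
the algebraic closure of `k` in `κ(W)`): `A = k[x,y,z]`, `𝔮 = (z, g(x,y))` with `g = 0` a
non-rational plane curve, `W = ord_𝔮`; `A_𝔮` is regular of dimension `2` and
`κ(W) = Frac(k[x,y]/(g))(t)` is ruled, not rational. What the proof delivers — `κ(W)` purely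
transcendental of degree `dim S - 1 ≥ 1` over the residue field of the penultimate (regular)
quadratic transform `S ⊇ A_𝔮` — is the honest strong form; `L ⊇ κ(𝔮)` and `L/k` finitely
generated come for free and are TRUE, hence not refutable strengthenings.

## (c) Natural strengthenings — none refutable cheaply

"`dim ≥ 2` replaced by `dim ≥ 1`" is exactly `RegularModelRuledWithoutDimTwo` (refuted above).
"regular replaced by normal" is refuted on paper by the same cone (normal, not regular).

## (d) Targets

None: `stuck_stubs = []`; line `dvr-descent` has no open stub (v4 proves `stub_ratFuncRuled`,
`stub_centreEqOfPrime`, `stub_chartQuotient`). -/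

end Summit.ResolutionOfSingularities.ResolutionOfSingularities.Cruxes.RegularModelRuled.Disproof

end
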